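import Summits.ResolutionOfSingularities.ResolutionOfSingularities.Theses.Valuative
import Literature.AlgebraicGeometry.Resolution.PerronTransforms

/-!
# `Valuative.LuAlphaPTorsor`, toroidal exit — helper file 3: the monomial chart

Route `ResolutionOfSingularities/Valuative`, crux `LuAlphaPTorsor` (stmt-0641), line
`pfaff-line-log-final-forms`, stub `stub_toroidalExit`. The combinatorial step of toric local
uniformization of the binomial hypersurface `w ^ p = v^M` along a valuation ring `O ⊆ K`:

**`exists_monomial_chart`.** Let `v₁, …, v_d, w ∈ K` be non-zero elements of positive value
(`ν(v_i) < 1`, `ν(w) < 1`) with `w ^ p = ∏ v_i ^ M_i` (`p = char K`), such that the monomials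
`∏ v_i ^ a_i`, `a ∈ ℕ^d`, are pairwise distinct. Then there are `n ≤ d` elements
`z₁, …, z_n ∈ O` (Laurent monomials in `v, w`) such that every `v_i` and `w` is a monomial in
the `z_j` with exponents in `ℕ`.

*Proof.* The subgroup `Λ ⊆ Kˣ` generated by `v, w` is a finitely generated `ℤ`-module; it is
torsion-free (a torsion element `λ` has `λ^p` a Laurent monomial in `v` with a torsion exponent
vector, hence `λ^p = 1`, hence `λ = 1` by Frobenius), so free, of rank `≤ d` (`p · Λ ⊆ ⟨v⟩`).
Order `Λ` lexicographically by the value `ν` and then by the coordinates in some basis: a total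
order compatible with addition in which `x ≥ 0 ⇒ ν(x) ≤ 1` and the generators are positive.
Zariski–Perron (Knaf–Kuhlmann 2005, Lemma 4.2; PROVED in the tree,
`exists_basis_pos_forall_repr_nonneg` of `PerronTransforms.lean`) gives a basis of positive
elements in which the generators have non-negative coordinates.
-/

noncomputable section

-- `Summit.<S>.<S>.…` duplicates the summit name by design (D-0017, single-problem summit).
set_option linter.dupNamespace false

namespace Summit.ResolutionOfSingularities.ResolutionOfSingularities.Theorems.PfaffLine

open Literature.AlgebraicGeometry.Resolution

section Lattice

variable {K : Type} [Field K]

/-- Laurent monomials: for non-zero `v_i`, `∏ v_i ^ e_i = (∏ v_i ^ e_i⁺) / (∏ v_i ^ e_i⁻)`. -/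
theorem prod_zpow_eq_div {d : ℕ} (v : Fin d → K) (hv : ∀ i, v i ≠ 0) (e : Fin d → ℤ) :
    ∏ i, v i ^ e i = (∏ i, v i ^ (e i).toNat) / ∏ i, v i ^ (-e i).toNat := by
  rw [← Finset.prod_div_distrib]
  refine Finset.prod_congr rfl fun i _ => ?_
  rw [← zpow_natCast, ← zpow_natCast, ← zpow_sub₀ (hv i), Int.toNat_sub_toNat_neg]

/-- If the `ℕ`-monomials in `v` are pairwise distinct, a Laurent monomial `∏ v_i ^ e_i = 1` has
`e = 0`. -/
theorem eq_zero_of_prod_zpow_eq_one {d : ℕ} (v : Fin d → K) (hv : ∀ i, v i ≠ 0)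
    (hind : ∀ a b : Fin d → ℕ, ∏ i, v i ^ a i = ∏ i, v i ^ b i → a = b) (e : Fin d → ℤ)
    (he : ∏ i, v i ^ e i = 1) : e = 0 := by
  rw [prod_zpow_eq_div v hv,
    div_eq_one_iff_eq (Finset.prod_ne_zero_iff.mpr fun i _ => pow_ne_zero _ (hv i))] at he
  have h := hind _ _ he
  funext i
  have hi : (e i).toNat = (-e i).toNat := congrFun h i
  change e i = 0
  omega

/-- **The monomial chart** (toric local uniformization of `w ^ p = v^M`, combinatorial part;
see the module docstring). -/
theorem exists_monomial_chart : ∀ {K : Type} [Field K] (p : ℕ) [Fact p.Prime] [CharP K p] (O : ValuationSubring K) {d : ℕ} (v : Fin d → K) (w : K) (M : Fin d → ℕ), (∀ i, v i ≠ 0) → (∀ i, O.valuation (v i) < 1) → O.valuation w < 1 → w ^ p = ∏ i, v i ^ M i → (∀ a b : Fin d → ℕ, ∏ i, v i ^ a i = ∏ i, v i ^ b i → a = b) → ∃ (n : ℕ) (z : Fin n → K) (N : Fin d → Fin n → ℕ) (NT : Fin n → ℕ), n ≤ d ∧ (∀ j, z j ∈ O) ∧ (∀ i, v i = ∏ j,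 z j ^ N i j) ∧ w = ∏ j, z j ^ NT j := by
  intro K _ p hp _ O d v w M hv0 hv1 hw1 hw hind
  classical
  have hp1 : p ≠ 0 := hp.out.ne_zero
  have hw0 : w ≠ 0 := fun h => by
    rw [h, zero_pow hp1] at hw
    exact (Finset.prod_ne_zero_iff.mpr fun i _ => pow_ne_zero _ (hv0 i)) hw.symm
  -- ### the lattice `Λ = ⟨v, w⟩ ⊆ Kˣ`, written additively
  let g : Option (Fin d) → Kˣ := fun o => o.elim (Units.mk0 w hw0) fun i => Units.mk0 (v i) (hv0 i)
  let e : Option (Fin d) → Additive Kˣ := fun o => Additive.ofMul (g o)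
  let V : Submodule ℤ (Additive Kˣ) := Submodule.span ℤ (Set.range e)
  -- values inside `K`
  let val : Additive Kˣ → K := fun a => ((Additive.toMul a : Kˣ) : K)
  have val_zero : val 0 = 1 := by simp [val]
  have val_nsmul : ∀ (n : ℕ) a, val (n • a) = val a ^ n := fun n a => by
    simp only [val, toMul_nsmul, Units.val_pow_eq_pow_val]
  have val_zsmul : ∀ (n : ℤ) a, val (n • a) = val a ^ n := fun n a => by
    simp only [val, toMul_zsmul, Units.val_zpow_eq_zpow_val]
  have val_add : ∀ a b, val (a + b) = val a * val b := fun a b => by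
    simp only [val, toMul_add, Units.val_mul]
  have val_sum : ∀ {ι : Type} (s : Finset ι) (f : ι → Additive Kˣ),
      val (∑ i ∈ s, f i) = ∏ i ∈ s, val (f i) := fun s f => by
    simp only [val, toMul_sum, Units.coe_prod]
  have val_e_some : ∀ i, val (e (some i)) = v i := fun i => by simp [val, e, g]
  have val_e_none : val (e none) = w := by simp [val, e, g]
  have val_inj : Function.Injective val := fun a b h =>
    Additive.toMul.injective (Units.ext h)
  -- Laurent monomials in `v`
  let mono : (Fin d → ℤ) → K := fun c => ∏ i, v i ^ c i
  have mono_ne : ∀ c, mono c ≠ 0 := fun c =>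
    Finset.prod_ne_zero_iff.mpr fun i _ => zpow_ne_zero _ (hv0 i)
  have mono_smul : ∀ (n : ℤ) c, mono (n • c) = mono c ^ n := fun n c => by
    simp only [mono, Pi.smul_apply, smul_eq_mul, ← Finset.prod_zpow]
    exact Finset.prod_congr rfl fun i _ => by rw [mul_comm, zpow_mul]
  have mono_add : ∀ c c', mono (c + c') = mono c * mono c' := fun c c' => by
    simp only [mono, Pi.add_apply, ← Finset.prod_mul_distrib]
    exact Finset.prod_congr rfl fun i _ => zpow_add₀ (hv0 i) _ _
  have val_lin : ∀ c : Fin d → ℤ, val (∑ i, c i • e (some i)) = mono c := fun c => by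
    rw [val_sum]
    exact Finset.prod_congr rfl fun i _ => by rw [val_zsmul, val_e_some]
  have hwM : w ^ p = mono fun i => (M i : ℤ) := by
    rw [hw]
    exact Finset.prod_congr rfl fun i _ => (zpow_natCast _ _).symm
  -- `(val x) ^ p` is a Laurent monomial in `v` for `x ∈ V`
  have hpV : ∀ x ∈ V, ∃ c : Fin d → ℤ, val x ^ p = mono c := by
    intro x hx
    obtain ⟨c, rfl⟩ := (Submodule.mem_span_range_iff_exists_fun ℤ).mp hx
    refine ⟨c none • (fun i => (M i : ℤ)) + (p : ℤ) • (c ∘ some), ?_⟩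
    have h1 : val (∑ o, c o • e o) = w ^ c none * mono (c ∘ some) := by
      rw [val_sum, Fintype.prod_option, val_zsmul, val_e_none, ← val_lin, val_sum]
      rfl
    have h2 : (w ^ c none) ^ p = mono (c none • fun i => (M i : ℤ)) := by
      rw [mono_smul, ← hwM, ← zpow_natCast, ← zpow_mul, mul_comm, zpow_mul, zpow_natCast]
    have h3 : mono (c ∘ some) ^ p = mono ((p : ℤ) • (c ∘ some)) := by
      rw [mono_smul, zpow_natCast]
    rw [h1, mul_pow, h2, h3, mono_add]
  -- ### torsion-freeness (Frobenius)
  have htf : ∀ x ∈ V, ∀ n : ℤ, n ≠ 0 → n • x = 0 → x = 0 := by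
    intro x hx n hn hnx
    obtain ⟨c, hc⟩ := hpV x hx
    have h0 : val x ^ n = 1 := by rw [← val_zsmul, hnx, val_zero]
    have h1 : mono (n • c) = 1 := by
      rw [mono_smul, ← hc, ← zpow_natCast, ← zpow_mul, mul_comm, zpow_mul, h0, one_zpow]
    have h2 : c = 0 := by
      have := eq_zero_of_prod_zpow_eq_one v hv0 hind _ h1
      exact (smul_eq_zero.mp this).resolve_left hn
    have h3 : val x ^ p = 1 := by
      rw [hc, h2]
      simp [mono]
    have h4 : val x = 1 := by
      have : frobenius K p (val x) = frobenius K p 1 := by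
        rw [frobenius_def, frobenius_def, h3, one_pow]
      exact frobenius_inj K p this
    apply val_inj
    rw [h4, val_zero]
  haveI : Module.IsTorsionFree ℤ V := by
    refine Module.IsTorsionFree.of_smul_eq_zero fun n x h => ?_
    by_cases hn : n = 0
    · exact Or.inl hn
    · right
      exact Subtype.ext (htf x x.2 n hn (by simpa using congrArg Subtype.val h))
  haveI : Module.Finite ℤ V := Module.Finite.span_of_finite ℤ (Set.finite_range e)
  haveI : Module.Free ℤ V := Module.free_of_finite_type_torsion_free'
  -- ### the rank: `finrank V ≤ d` (multiplication by `p` maps `V` into `⟨v⟩`)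
  have hrank : Module.finrank ℤ V ≤ d := by
    let ψ : V →ₗ[ℤ] Additive Kˣ := (p : ℤ) • V.subtype
    have hψ : Function.Injective ψ := by
      intro x y hxy
      have h : (p : ℤ) • (x : Additive Kˣ) = (p : ℤ) • (y : Additive Kˣ) := hxy
      have h' : val x ^ p = val y ^ p := by
        rw [← zpow_natCast, ← zpow_natCast, ← val_zsmul, ← val_zsmul, h]
      have : frobenius K p (val x) = frobenius K p (val y) := by
        rw [frobenius_def, frobenius_def, h']
      exact Subtype.ext (val_inj (frobenius_inj K p this))
    have hle : LinearMap.range ψ ≤ Submodule.span ℤ (Set.range (e ∘ some)) := by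
      rintro _ ⟨x, rfl⟩
      obtain ⟨c, hc⟩ := hpV x x.2
      have : (p : ℤ) • (x : Additive Kˣ) = ∑ i, c i • e (some i) := by
        apply val_inj
        rw [val_zsmul, zpow_natCast, hc, val_lin]
      change (p : ℤ) • (x : Additive Kˣ) ∈ _
      rw [this]
      exact (Submodule.mem_span_range_iff_exists_fun ℤ).mpr ⟨c, rfl⟩
    haveI : Module.Finite ℤ (Submodule.span ℤ (Set.range (e ∘ some))) :=
      Module.Finite.span_of_finite ℤ (Set.finite_range _)
    calc Module.finrank ℤ V = Module.finrank ℤ (LinearMap.range ψ) :=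
          (LinearMap.finrank_range_of_inj hψ).symm
      _ ≤ Module.finrank ℤ (Submodule.span ℤ (Set.range (e ∘ some))) :=
          Submodule.finrank_mono hle
      _ ≤ d := (finrank_range_le_card _).trans (by simp)
  -- ### the total order on `V`: by value, then lexicographically in a basis
  let b₀ := Module.finBasis ℤ V
  let tie : V →ₗ[ℤ] (Fin (Module.finrank ℤ V) → ℤ) := b₀.equivFun.toLinearMap
  have htie : Function.Injective tie := b₀.equivFun.injective
  let νa : V → O.ValueGroup := fun x => O.valuation (val x)
  have νa_add : ∀ x y : V, νa (x + y) = νa x * νa y := fun x y => by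
    simp only [νa, Submodule.coe_add, val_add, map_mul]
  have νa_ne : ∀ x : V, νa x ≠ 0 := fun x => by
    simp only [νa, ne_eq, map_eq_zero, val]
    exact Units.ne_zero _
  have νa_zero : νa 0 = 1 := by simp [νa, val_zero]
  let f : V → Lex ((O.ValueGroup)ᵒᵈ × Lex (Fin (Module.finrank ℤ V) → ℤ)) :=
    fun x => toLex (OrderDual.toDual (νa x), toLex (tie x))
  have hf : Function.Injective f := fun x y hxy => by
    apply htie
    have := congrArg (fun q => ofLex (ofLex q).2) hxy
    simpa [f] using this
  letI : LinearOrder V := LinearOrder.lift' f hf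
  have hle : ∀ x y : V, x ≤ y ↔ f x ≤ f y := fun _ _ => Iff.rfl
  have hlt : ∀ x y : V, x < y ↔ f x < f y := fun x y => by
    rw [lt_iff_le_not_ge, hle, hle, lt_iff_le_not_ge]
  have hmono : ∀ a b : V, a ≤ b → ∀ c : V, a + c ≤ b + c := by
    intro a b hab c
    rw [hle] at hab ⊢
    simp only [f, Prod.Lex.toLex_le_toLex, OrderDual.toDual_lt_toDual,
      OrderDual.toDual_inj] at hab ⊢
    rcases hab with h | ⟨h1, h2⟩
    · left
      rw [νa_add, νa_add]
      exact mul_lt_mul_of_pos_right h (zero_lt_iff.mpr (νa_ne c))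
    · right
      refine ⟨by rw [νa_add, νa_add, h1], ?_⟩
      rw [show tie (a + c) = tie a + tie c from map_add tie a c,
        show tie (b + c) = tie b + tie c from map_add tie b c, toLex_add, toLex_add]
      exact add_le_add h2 le_rfl
  haveI : IsOrderedAddMonoid V :=
    { add_le_add_left := fun a b hab c => hmono a b hab c
      add_le_add_right := fun a b hab c => by
        rw [add_comm c, add_comm c]
        exact hmono a b hab c }
  -- sign conditions
  have hpos : ∀ x : V, νa x < 1 → 0 < x := fun x hx => by
    rw [hlt]
    simp only [f, Prod.Lex.toLex_lt_toLex, OrderDual.toDual_lt_toDual]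
    left
    rwa [νa_zero]
  have hO : ∀ x : V, 0 ≤ x → val x ∈ O := fun x hx => by
    rw [hle] at hx
    simp only [f, Prod.Lex.toLex_le_toLex, OrderDual.toDual_lt_toDual,
      OrderDual.toDual_inj] at hx
    rw [← O.valuation_le_one_iff]
    change νa x ≤ 1
    rw [νa_zero] at hx
    rcases hx with h | ⟨h, -⟩
    · exact le_of_lt h
    · exact le_of_eq h.symm
  -- ### Perron's positive basis
  have he_mem : ∀ o, e o ∈ V := fun o => Submodule.subset_span (Set.mem_range_self o)
  let eV : Option (Fin d) → V := fun o => ⟨e o, he_mem o⟩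
  have heV_pos : ∀ o, 0 < eV o := fun o => by
    apply hpos
    cases o with
    | none => simpa [νa, eV, val_e_none] using hw1
    | some i => simpa [νa, eV, val_e_some] using hv1 i
  obtain ⟨b, hb, hbS⟩ := exists_basis_pos_forall_repr_nonneg (Γ := V)
    (Finset.univ.image eV) fun s hs => by
      obtain ⟨o, -, rfl⟩ := Finset.mem_image.mp hs
      exact (heV_pos o).le
  have hrepr : ∀ o j, 0 ≤ b.repr (eV o) j := fun o j =>
    hbS _ (Finset.mem_image_of_mem _ (Finset.mem_univ o)) j
  -- ### the chart
  let z : Fin (Module.finrank ℤ V) → K := fun j => val (b j)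
  have hexp : ∀ o, val (eV o) = ∏ j, z j ^ (b.repr (eV o) j).toNat := fun o => by
    have hsum : ∑ j, (b.repr (eV o) j).toNat • b j = eV o := by
      conv_rhs => rw [← b.sum_repr (eV o)]
      refine Finset.sum_congr rfl fun j _ => ?_
      rw [← natCast_zsmul, Int.toNat_of_nonneg (hrepr o j)]
    have := congrArg (fun x : V => val x) hsum
    rw [← this, Submodule.coe_sum, val_sum]
    exact Finset.prod_congr rfl fun j _ => by
      rw [Submodule.coe_smul_of_tower, val_nsmul]
  refine ⟨Module.finrank ℤ V, z, fun i j => (b.repr (eV (some i)) j).toNat,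
    fun j => (b.repr (eV none) j).toNat, hrank, fun j => hO _ (hb j).le, fun i => ?_, ?_⟩
  · rw [← hexp (some i)]
    exact (val_e_some i).symm
  · rw [← hexp none]
    exact val_e_none.symm

end Lattice

end Summit.ResolutionOfSingularities.ResolutionOfSingularities.Theorems.PfaffLine

end
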